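import Summits.HodgeConjecture.HodgeConjecture.Theorems.F0P3bKTypeIntegration
import Mathlib.Tactic.Module
import HarnessLib

/-!
# `K`-integration of Kovačević's `K`-type modules, II: the weak derivative along `𝔨` and the `(𝔤, K)`-module

Route `F0_ThetaPinDelta`, line `Cruxes/H413/Lines/F0_LocalAPackets.lean` (crux item H413), stub `StubT3aRealisationDatum`,
waypoint **W1** (`StubW1KIntegration`; lead A-p03 (g18), pen F0P3b-plan (g5)).  Namespace
`Summit.HodgeConjecture.HodgeConjecture.Cruxes.H413.F0P3bKTypeIntegrationGK`.  PROOF lane (theorems only; no def, no instance, no notation,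
no named fact, no `sorry`); Kovačević-free (the module `SU21ModulesFromKTypes` is not imported).

Over ★ `F0P3bKTypeIntegration` (`KIdx`, `kvec`, `cnorm`, `kTypeMat`, `kTypeRep`, `ActsOnKTypes`; `K`-finiteness and weak continuity):
* §1 the tridiagonal identity `tri_sum`: conjugating ★ `dSymPowerMat` by `diag(cnorm)` yields Kovačević's `X_α ∕ Y_α` coefficients, and
  `diag_coeff`: the exponents `a = (m − 3n + 3)/6`, `b = −m/3` solve the diagonal (`H_α`, `H_β`, centre);
* §2 **`hasDerivAt_coeff`**: `d/dt|₀ ℓ (ρK (exp tX) v) = ℓ (ρ𝔤 X v)` for `X ∈ 𝔨` under `ActsOnKTypes S ρ𝔤`; **`isGKModule_kTypeRep`** and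
  **`exists_isGKModule_of_kTypeFormulas`** (`Ad`-compatibility by ★ `IsGKModule.of_hasWeakDeriv_of_expK_surjective` + ★ `upq_exists_expK_eq`);
* §3 **`actsOnKTypes_of_kovacevicForm`**: the `𝔨`-hypothesis `ActsOnKTypes S ρ𝔤` from the coordinates the Kovačević module delivers
  (`ρfun`'s eight-operator decomposition of the reindexed matrix + the VERBATIM shapes of `Ha_vec`, `Hb_vec`, `Xa_vec`, `Ya_vec`), so that
  `IsGKModule G21 (kTypeRep ladderPlus.S) (kovLie ladderPlus.ρ)` — hence `StubW1KIntegration` (`m = 3n − 3`: `a = 0`, `b = 1 − n`) — is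
  `isGKModule_kTypeRep` applied to it once that module's olean serves.

HONEST LABEL: HC_CM is proved only modulo the printed citations until rung 0 closes; this is one waypoint of one engine stub.
[cite: BorelWallach2000, 0 §2.5; VI §4 4.7–4.8] [cite: Kovacevic2021, §3 Def. 1, Thm. 1; §6] -/

noncomputable section

open scoped MatrixGroups Matrix

namespace Summit.HodgeConjecture.HodgeConjecture.Cruxes.H413.F0P3bKTypeIntegrationGK

open Literature.NumberTheory.Automorphic
open Literature.RepresentationTheory.BorelWallach2000
open Literature.RepresentationTheory.KonnoKonno2007 Literature.RepresentationTheory.KonnoKonno2007.RealDualPair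
open Literature.RepresentationTheory.KonnoKonno2007.RealDualPair.UForm
open Literature.RepresentationTheory.AlgebraicGroups.SL2Sym
open Summit.HodgeConjecture.HodgeConjecture.Cruxes.H413.F0P3bSymPowerDerivation
open Summit.HodgeConjecture.HodgeConjecture.Cruxes.H413.F0P3bSymPowerCalculus
open Summit.HodgeConjecture.HodgeConjecture.Cruxes.H413.F0P3bKTypeCalculus
open Summit.HodgeConjecture.HodgeConjecture.Cruxes.H413.F0P3bKTypeIntegration

-- Mathlib idiom (as in `GKModules`, the `Upq*` files and ★ `GKModulesAdCompatOfWeakDeriv`): the commutator bracket on `Module.End`,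
-- needed to state `𝔤 →ₗ⁅ℝ⁆ Module.End ℂ V`
attribute [local instance 100] LieRing.ofAssociativeRing

set_option autoImplicit false
set_option linter.dupNamespace false

/-! ## §1 The tridiagonal identity: `cnorm⁻¹ · dSym^{N}(X₁₁) · cnorm` has Kovačević's coefficients -/

section Tridiagonal

/-- **`Σ_l (cnorm i / cnorm l) (s δ_{li} + dSym^N(X)_{li}) w(l+1) = (s + (N−i)x₀₀ + i x₁₁) w(i+1) − i(N+1−i) x₀₁ w(i) − x₁₀ w(i+2)`**
for any `w : ℤ → ℂ` with `w (N+2) = 0`: conjugating the tridiagonal derivation matrix ★ `dSymPowerMat` by the dictionary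
`diag(cnorm)` produces exactly Kovačević's `u`-basis coefficients of `X_α = E₀₁` (`−(k−1)(n+1−k)` on `u^{k−1}`) and `Y_α = E₁₀`
(`−1` on `u^{k+1}`), `k = i + 1`, `n = N + 1`. [cite: Kovacevic2021, §3 Def. 1] [cite: BorelWallach2000, 0 §2.5] -/
theorem tri_sum (N : ℕ) (i : Fin (N + 1)) (X : Matrix (Fin 2) (Fin 2) ℂ) (s : ℂ) (w : ℤ → ℂ)
    (hw : w ((N : ℤ) + 2) = 0) :
    ∑ l : Fin (N + 1), cnorm N i / cnorm N l * (s * (if l = i then 1 else 0) + dSymPowerMat N X l i) * w ((l : ℕ) + 1)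
      = (s + ((N : ℂ) - i) * X 0 0 + (i : ℂ) * X 1 1) * w ((i : ℕ) + 1)
        + (-(X 0 1 * ((i : ℂ) * ((N : ℂ) + 1 - i)))) * w (i : ℕ)
        + (-X 1 0) * w ((i : ℕ) + 2) := by
  have hi : (i : ℕ) ≤ N := Nat.le_of_lt_succ i.2
  -- expand `dSym^N(X)` along the matrix units
  have hexp : ∀ l : Fin (N + 1), dSymPowerMat N X l i =
      X 0 0 * (if l = i then ((N : ℂ) - ((i : ℕ) : ℂ)) else 0) +
      X 0 1 * (if (i : ℕ) = (l : ℕ) + 1 then ((i : ℕ) : ℂ) else 0) +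
      X 1 0 * (if (l : ℕ) = (i : ℕ) + 1 then ((N : ℂ) - ((i : ℕ) : ℂ)) else 0) +
      X 1 1 * (if l = i then ((i : ℕ) : ℂ) else 0) := by
    intro l
    rw [dSymPowerMat_apply_eq_sum_single, Fin.sum_univ_two, Fin.sum_univ_two, Fin.sum_univ_two,
      dSymPowerMat_single_zero_zero, dSymPowerMat_single_zero_one, dSymPowerMat_single_one_zero,
      dSymPowerMat_single_one_one]
    ring
  simp_rw [hexp]
  -- split into the five elementary sums
  have e1 : ∑ l : Fin (N + 1), cnorm N i / cnorm N l * (s * (if l = i then 1 else 0)) * w ((l : ℕ) + 1) =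
      s * w ((i : ℕ) + 1) := by
    rw [Finset.sum_eq_single i]
    · rw [if_pos rfl, cnorm_div_self hi]; ring
    · intro l _ hl; rw [if_neg hl]; ring
    · intro h; exact absurd (Finset.mem_univ _) h
  have e2 : ∑ l : Fin (N + 1), cnorm N i / cnorm N l * (X 0 0 * (if l = i then ((N : ℂ) - ((i : ℕ) : ℂ)) else 0)) *
      w ((l : ℕ) + 1) = ((N : ℂ) - i) * X 0 0 * w ((i : ℕ) + 1) := by
    rw [Finset.sum_eq_single i]
    · rw [if_pos rfl, cnorm_div_self hi]; ring
    · intro l _ hl; rw [if_neg hl]; ring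
    · intro h; exact absurd (Finset.mem_univ _) h
  have e5 : ∑ l : Fin (N + 1), cnorm N i / cnorm N l * (X 1 1 * (if l = i then ((i : ℕ) : ℂ) else 0)) *
      w ((l : ℕ) + 1) = (i : ℂ) * X 1 1 * w ((i : ℕ) + 1) := by
    rw [Finset.sum_eq_single i]
    · rw [if_pos rfl, cnorm_div_self hi]; ring
    · intro l _ hl; rw [if_neg hl]; ring
    · intro h; exact absurd (Finset.mem_univ _) h
  have e3 : ∑ l : Fin (N + 1), cnorm N i / cnorm N l * (X 0 1 * (if (i : ℕ) = (l : ℕ) + 1 then ((i : ℕ) : ℂ) else 0)) *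
      w ((l : ℕ) + 1) = (-(X 0 1 * ((i : ℂ) * ((N : ℂ) + 1 - i)))) * w (i : ℕ) := by
    by_cases h0 : (i : ℕ) = 0
    · rw [Finset.sum_eq_zero]
      · rw [h0]; push_cast; ring
      · intro l _
        rw [if_neg (by omega)]; ring
    · obtain ⟨i₀, hi₀⟩ : ∃ i₀ : ℕ, (i : ℕ) = i₀ + 1 := ⟨(i : ℕ) - 1, by omega⟩
      have hi₀N : i₀ < N + 1 := by omega
      rw [Finset.sum_eq_single (⟨i₀, hi₀N⟩ : Fin (N + 1))]
      · rw [if_pos (by exact hi₀)]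
        have hc : cnorm N i = -(((N : ℂ) - i₀) * cnorm N i₀) := by
          rw [show (i : ℕ) = i₀ + 1 from hi₀]; exact cnorm_succ (by omega)
        have hz : ((((⟨i₀, hi₀N⟩ : Fin (N + 1)) : ℕ) : ℤ) + 1) = ((i : ℕ) : ℤ) := by simp [hi₀]
        rw [hz, hc]
        have hne : cnorm N i₀ ≠ 0 := cnorm_ne_zero (by omega)
        have hcast : ((i : ℕ) : ℂ) = (i₀ : ℂ) + 1 := by rw [hi₀]; push_cast; ring
        field_simp
        rw [hcast]
        ring
      · intro l _ hl
        rw [if_neg]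
        · ring
        · intro hil
          apply hl
          exact Fin.ext (by simp; omega)
      · intro h; exact absurd (Finset.mem_univ _) h
  have e4 : ∑ l : Fin (N + 1), cnorm N i / cnorm N l * (X 1 0 * (if (l : ℕ) = (i : ℕ) + 1 then ((N : ℂ) - ((i : ℕ) : ℂ)) else 0)) *
      w ((l : ℕ) + 1) = (-X 1 0) * w ((i : ℕ) + 2) := by
    by_cases hN : (i : ℕ) = N
    · rw [Finset.sum_eq_zero]
      · have : (((i : ℕ) : ℤ) + 2) = (N : ℤ) + 2 := by rw [hN]
        rw [this, hw]; ring
      · intro l _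
        rw [if_neg (by omega)]; ring
    · have hlt : (i : ℕ) + 1 < N + 1 := by omega
      rw [Finset.sum_eq_single (⟨(i : ℕ) + 1, hlt⟩ : Fin (N + 1))]
      · rw [if_pos rfl]
        have hc : cnorm N ((i : ℕ) + 1) = -(((N : ℂ) - i) * cnorm N i) := cnorm_succ hi
        have hz : ((((⟨(i : ℕ) + 1, hlt⟩ : Fin (N + 1)) : ℕ) : ℤ) + 1) = ((i : ℕ) : ℤ) + 2 := by simp; ring
        rw [hz, hc]
        have hne : cnorm N i ≠ 0 := cnorm_ne_zero hi
        have hNi : ((N : ℂ) - i) ≠ 0 := by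
          rw [sub_ne_zero]; exact_mod_cast (Ne.symm hN)
        field_simp
      · intro l _ hl
        rw [if_neg]
        · ring
        · intro hil
          apply hl
          exact Fin.ext (by simpa using hil)
      · intro h; exact absurd (Finset.mem_univ _) h
  -- assemble
  have hsplit : ∀ l : Fin (N + 1),
      cnorm N i / cnorm N l * (s * (if l = i then 1 else 0) +
        (X 0 0 * (if l = i then ((N : ℂ) - ((i : ℕ) : ℂ)) else 0) +
         X 0 1 * (if (i : ℕ) = (l : ℕ) + 1 then ((i : ℕ) : ℂ) else 0) +
         X 1 0 * (if (l : ℕ) = (i : ℕ) + 1 then ((N : ℂ) - ((i : ℕ) : ℂ)) else 0) +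
         X 1 1 * (if l = i then ((i : ℕ) : ℂ) else 0))) * w ((l : ℕ) + 1) =
      cnorm N i / cnorm N l * (s * (if l = i then 1 else 0)) * w ((l : ℕ) + 1) +
      cnorm N i / cnorm N l * (X 0 0 * (if l = i then ((N : ℂ) - ((i : ℕ) : ℂ)) else 0)) * w ((l : ℕ) + 1) +
      cnorm N i / cnorm N l * (X 0 1 * (if (i : ℕ) = (l : ℕ) + 1 then ((i : ℕ) : ℂ) else 0)) * w ((l : ℕ) + 1) +
      cnorm N i / cnorm N l * (X 1 0 * (if (l : ℕ) = (i : ℕ) + 1 then ((N : ℂ) - ((i : ℕ) : ℂ)) else 0)) * w ((l : ℕ) + 1) +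
      cnorm N i / cnorm N l * (X 1 1 * (if l = i then ((i : ℕ) : ℂ) else 0)) * w ((l : ℕ) + 1) := by
    intro l; ring
  simp_rw [hsplit, Finset.sum_add_distrib, e1, e2, e3, e4, e5]
  ring

/-- **The diagonal**: with `a = (m − 3n + 3)/6`, `b = −m/3` (`6 ∣ m − 3n + 3`), `N = n − 1`, `i = k − 1`,
`a (x₀₀ + x₁₁) + b x₂₂ + (N − i) x₀₀ + i x₁₁` is Kovačević's `𝔨`-diagonal coefficient
`((2x₀₀ − x₁₁ − x₂₂)/3)(n+1−2k) + ((x₀₀ + x₁₁ − 2x₂₂)/3)(m−n−1+2k)/2` (`H_α ↦ n+1−2k`, `H_β ↦ (m−n−1+2k)/2`, centre `↦ 0`).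
[cite: Kovacevic2021, §3 Def. 1] -/
theorem diag_coeff {n m : ℤ} (h6 : (6 : ℤ) ∣ m - 3 * n + 3) {N : ℕ} (hN : (N : ℤ) = n - 1) (i : ℕ) {k : ℤ}
    (hk : (i : ℤ) = k - 1) (x₀₀ x₁₁ x₂₂ : ℂ) :
    (((m - 3 * n + 3) / 6 : ℤ) : ℂ) * (x₀₀ + x₁₁) + ((-(m / 3) : ℤ) : ℂ) * x₂₂ + ((N : ℂ) - i) * x₀₀ + (i : ℂ) * x₁₁ =
      (2 * x₀₀ - x₁₁ - x₂₂) / 3 * ((n : ℂ) + 1 - 2 * k) + (x₀₀ + x₁₁ - 2 * x₂₂) / 3 * (((m : ℂ) - n - 1 + 2 * k) / 2) := by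
  have h3 : (3 : ℤ) ∣ m := by omega
  have ha : (((m - 3 * n + 3) / 6 : ℤ) : ℂ) * 6 = (m : ℂ) - 3 * n + 3 := by exact_mod_cast Int.ediv_mul_cancel h6
  have hb : (((m / 3) : ℤ) : ℂ) * 3 = (m : ℂ) := by exact_mod_cast Int.ediv_mul_cancel h3
  have hN' : (N : ℂ) = (n : ℂ) - 1 := by exact_mod_cast hN
  have hi' : (i : ℂ) = (k : ℂ) - 1 := by exact_mod_cast hk
  push_cast
  linear_combination (x₀₀ + x₁₁) / 6 * ha - x₂₂ / 3 * hb + x₀₀ * hN' + (x₁₁ - x₀₀) * hi'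

end Tridiagonal

/-! ## §2 The weak derivative along `𝔨` and the `(𝔤, K)`-module -/

section GK

variable {S : Set (ℤ × ℤ)}

/-- **The derivative of the matrix coefficient of a basis vector along `exp tX`, `X ∈ 𝔨`**, as the explicit `Fin`-sum.
[cite: BorelWallach2000, 0 §2.5] -/
theorem hasDerivAt_coeff_kTypeImg (ℓ : Module.Dual ℂ (KIdx S →₀ ℂ)) (X : (uFormGroup (Fin 2) (Fin 1)).compactLie)
    (n m k : ℤ) (h : (n, m) ∈ S ∧ 1 ≤ k ∧ k ≤ n) :
    HasDerivAt (fun t : ℝ => ℓ (kTypeImg S ((uFormGroup (Fin 2) (Fin 1)).expK (t • X)) ⟨(n, m, k), h⟩))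
      (∑ l : Fin ((n - 1).toNat + 1),
        cnorm ((n - 1).toNat) ((k - 1).toNat) / cnorm ((n - 1).toNat) l *
          (((((m - 3 * n + 3) / 6 : ℤ) : ℂ) * ((X : Matrix (Fin 2 ⊕ Fin 1) (Fin 2 ⊕ Fin 1) ℂ).toBlocks₁₁).trace +
              ((-(m / 3) : ℤ) : ℂ) * (X : Matrix (Fin 2 ⊕ Fin 1) (Fin 2 ⊕ Fin 1) ℂ).toBlocks₂₂ 0 0) *
              (if l = (⟨(k - 1).toNat, by obtain ⟨-, -, h2⟩ := h; omega⟩ : Fin ((n - 1).toNat + 1)) then 1 else 0) +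
            dSymPowerMat ((n - 1).toNat) ((X : Matrix (Fin 2 ⊕ Fin 1) (Fin 2 ⊕ Fin 1) ℂ).toBlocks₁₁) l
              ⟨(k - 1).toNat, by obtain ⟨-, -, h2⟩ := h; omega⟩) *
          ℓ (kvec S n m ((l : ℕ) + 1))) 0 := by
  simp only [apply_kTypeImg]
  exact HasDerivAt.fun_sum fun l _ => (hasDerivAt_kTypeMat_expK n m X l _).mul_const _

/-- **The weak derivative along `𝔨`**: if `ρ𝔤|_𝔨` acts on the `u`-basis by Kovačević's formulas, then
`d/dt|₀ ℓ (ρK (exp tX) v) = ℓ (ρ𝔤 X v)` for `X ∈ 𝔨`. [cite: BorelWallach2000, 0 §2.5] [cite: Kovacevic2021, §3 Def. 1] -/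
theorem hasDerivAt_coeff (hS : ∀ n m : ℤ, (n, m) ∈ S → 1 ≤ n ∧ (6 : ℤ) ∣ m - 3 * n + 3)
    (ρ𝔤 : (uFormGroup (Fin 2) (Fin 1)).lie →ₗ⁅ℝ⁆ Module.End ℂ (KIdx S →₀ ℂ))
    (hρ : ActsOnKTypes S ρ𝔤)
    (X : (uFormGroup (Fin 2) (Fin 1)).compactLie) (v : KIdx S →₀ ℂ) (ℓ : Module.Dual ℂ (KIdx S →₀ ℂ)) :
    HasDerivAt (fun t : ℝ => ℓ (kTypeRep S ((uFormGroup (Fin 2) (Fin 1)).expK (t • X)) v))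
      (ℓ (ρ𝔤 (LieSubalgebra.inclusion (uFormGroup (Fin 2) (Fin 1)).compactLie_le_lie X) v)) 0 := by
  classical
  set X₁ := (X : Matrix (Fin 2 ⊕ Fin 1) (Fin 2 ⊕ Fin 1) ℂ).toBlocks₁₁ with hX₁
  set X₂ := (X : Matrix (Fin 2 ⊕ Fin 1) (Fin 2 ⊕ Fin 1) ℂ).toBlocks₂₂ with hX₂
  -- expand `v` along its support on both sides
  have hv : v = ∑ t ∈ v.support, v t • Finsupp.single t (1 : ℂ) := by
    conv_lhs => rw [← Finsupp.sum_single v]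
    simp only [Finsupp.sum, Finsupp.smul_single_one]
  have hfun : (fun t : ℝ => ℓ (kTypeRep S ((uFormGroup (Fin 2) (Fin 1)).expK (t • X)) v)) =
      fun t : ℝ => ∑ s ∈ v.support, v s * ℓ (kTypeImg S ((uFormGroup (Fin 2) (Fin 1)).expK (t • X)) s) := by
    funext t
    rw [kTypeRep_apply, kTypeEnd_apply, map_sum]
    simp only [map_smul, smul_eq_mul]
  have hval : ℓ (ρ𝔤 (LieSubalgebra.inclusion (uFormGroup (Fin 2) (Fin 1)).compactLie_le_lie X) v) =
      ∑ s ∈ v.support, v s * ℓ (ρ𝔤 (LieSubalgebra.inclusion (uFormGroup (Fin 2) (Fin 1)).compactLie_le_lie X)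
        (Finsupp.single s 1)) := by
    conv_lhs => rw [hv]
    rw [map_sum, map_sum]
    simp only [map_smul, smul_eq_mul]
  rw [hfun, hval]
  refine HasDerivAt.fun_sum fun s _ => HasDerivAt.const_mul (v s) ?_
  obtain ⟨⟨n, m, k⟩, hnm, hk1, hkn⟩ := s
  dsimp only at hnm hk1 hkn
  obtain ⟨hn1, h6⟩ := hS n m hnm
  -- the derivative of the coefficient, as a `Fin`-sum
  refine (hasDerivAt_coeff_kTypeImg ℓ X n m k ⟨hnm, hk1, hkn⟩).congr_deriv ?_
  -- evaluate the tridiagonal `Fin`-sum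
  set N : ℕ := (n - 1).toNat with hNdef
  have hN : (N : ℤ) = n - 1 := Int.toNat_of_nonneg (by omega)
  have hiN : (k - 1).toNat < N + 1 := by omega
  set i : Fin (N + 1) := ⟨(k - 1).toNat, hiN⟩ with hidef
  have hi : ((i : ℕ) : ℤ) = k - 1 := Int.toNat_of_nonneg (by omega)
  set s : ℂ := (((m - 3 * n + 3) / 6 : ℤ) : ℂ) * X₁.trace + ((-(m / 3) : ℤ) : ℂ) * X₂ 0 0 with hsdef
  set w : ℤ → ℂ := fun j => ℓ (kvec S n m j) with hwdef
  have hw : w ((N : ℤ) + 2) = 0 := by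
    simp only [hwdef]
    rw [kvec_of_neg (by omega), map_zero]
  have htri := tri_sum N i X₁ s w hw
  have hlhs : (∑ l : Fin (N + 1), cnorm N ((k - 1).toNat) / cnorm N l *
      (s * (if l = i then 1 else 0) + dSymPowerMat N X₁ l i) * ℓ (kvec S n m ((l : ℕ) + 1))) =
      ∑ l : Fin (N + 1), cnorm N i / cnorm N l * (s * (if l = i then 1 else 0) + dSymPowerMat N X₁ l i) *
        w ((l : ℕ) + 1) := rfl
  rw [hlhs, htri]
  -- the right-hand side: Kovačević's formula
  rw [single_eq_kvec, hρ X n m k hnm hk1 hkn]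
  simp only [map_add, map_smul, smul_eq_mul]
  -- match the three terms
  have hk0 : ((i : ℕ) : ℤ) + 1 = k := by omega
  have hkm : ((i : ℕ) : ℤ) = k - 1 := hi
  have hkp : ((i : ℕ) : ℤ) + 2 = k + 1 := by omega
  have hw1 : w ((i : ℕ) + 1) = ℓ (kvec S n m k) := by simp only [hwdef]; rw [hk0]
  have hw2 : w (i : ℕ) = ℓ (kvec S n m (k - 1)) := by simp only [hwdef]; rw [hkm]
  have hw3 : w ((i : ℕ) + 2) = ℓ (kvec S n m (k + 1)) := by simp only [hwdef]; rw [hkp]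
  rw [hw1, hw2, hw3]
  have hdiag := diag_coeff h6 hN (i : ℕ) hi (X₁ 0 0) (X₁ 1 1) (X₂ 0 0)
  have htr : X₁.trace = X₁ 0 0 + X₁ 1 1 := Matrix.trace_fin_two X₁
  have e00 : X₁ 0 0 = (X : Matrix (Fin 2 ⊕ Fin 1) (Fin 2 ⊕ Fin 1) ℂ) (Sum.inl 0) (Sum.inl 0) := rfl
  have e01 : X₁ 0 1 = (X : Matrix (Fin 2 ⊕ Fin 1) (Fin 2 ⊕ Fin 1) ℂ) (Sum.inl 0) (Sum.inl 1) := rfl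
  have e10 : X₁ 1 0 = (X : Matrix (Fin 2 ⊕ Fin 1) (Fin 2 ⊕ Fin 1) ℂ) (Sum.inl 1) (Sum.inl 0) := rfl
  have e11 : X₁ 1 1 = (X : Matrix (Fin 2 ⊕ Fin 1) (Fin 2 ⊕ Fin 1) ℂ) (Sum.inl 1) (Sum.inl 1) := rfl
  have e22 : X₂ 0 0 = (X : Matrix (Fin 2 ⊕ Fin 1) (Fin 2 ⊕ Fin 1) ℂ) (Sum.inr 0) (Sum.inr 0) := rfl
  have hi' : ((i : ℕ) : ℂ) = (k : ℂ) - 1 := by exact_mod_cast hi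
  have hN' : (N : ℂ) = (n : ℂ) - 1 := by exact_mod_cast hN
  rw [← e00, ← e01, ← e10, ← e11, ← e22, hsdef, htr]
  rw [hi', hN'] at hdiag ⊢
  linear_combination ℓ (kvec S n m k) * hdiag

/-- **`K`-INTEGRATION (the Kovačević-free half of W1).**  Let `S ⊂ ℤ²` be a set of `K`-type labels with `1 ≤ n` and
`6 ∣ m − 3n + 3` on `S`, `V = ⊕_{(n,m) ∈ S} V_{n,m}` the space with basis `u^k_{n,m}` (`1 ≤ k ≤ n`), and `ρ𝔤` a real Lie algebra
representation of `𝔲(2,1)` on `V` whose restriction to `𝔨 = 𝔲(2) ⊕ 𝔲(1)` acts on the basis by Kovačević's `u`-basis formulas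
(`H_α`, `H_β`, `X_α`, `Y_α` of §3 Def. 1, centre `↦ 0`).  Then `ρK := kTypeRep S` (`det^a ⊗ u^b ⊗ Sym^{n−1}` on `V_{n,m}`,
`a = (m−3n+3)/6`, `b = −m/3`, in the `u`-basis) makes `(ρK, ρ𝔤)` a `(𝔤, K)`-module of `U(2,1)`: `K`-finite, weakly continuous,
weak derivative `ρ𝔤|_𝔨`, and `Ad`-compatible (the last by ★ `IsGKModule.of_hasWeakDeriv_of_expK_surjective` and ★
`upq_exists_expK_eq`). [cite: BorelWallach2000, 0 §2.5] [cite: Kovacevic2021, §3 Def. 1; §6] -/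
theorem isGKModule_kTypeRep (hS : ∀ n m : ℤ, (n, m) ∈ S → 1 ≤ n ∧ (6 : ℤ) ∣ m - 3 * n + 3)
    (ρ𝔤 : (uFormGroup (Fin 2) (Fin 1)).lie →ₗ⁅ℝ⁆ Module.End ℂ (KIdx S →₀ ℂ))
    (hρ : ActsOnKTypes S ρ𝔤) :
    IsGKModule (uFormGroup (Fin 2) (Fin 1)) (kTypeRep S) ρ𝔤 :=
  IsGKModule.of_hasWeakDeriv_of_expK_surjective upq_exists_expK_eq finiteDimensional_span_orbit continuous_coeff
    (hasDerivAt_coeff hS ρ𝔤 hρ)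

/-- **W1, Kovačević-free form**: under the hypotheses of `isGKModule_kTypeRep` SOME `K`-action makes `(ρK, ρ𝔤)` a
`(𝔤, K)`-module — the shape of the line's `StubW1KIntegration` (`∃ ρK, IsGKModule G21 ρK (kovLie ladderPlus.ρ)`) once `S := ladderPlus.S`
(`m = 3n − 3`: `a = 0`, `b = 1 − n`) and `hρ` is read off Kovačević's `ρfun` on block-diagonal matrices.
[cite: BorelWallach2000, 0 §2.5] [cite: Kovacevic2021, §3 Def. 1; §6] -/
theorem exists_isGKModule_of_kTypeFormulas (hS : ∀ n m : ℤ, (n, m) ∈ S → 1 ≤ n ∧ (6 : ℤ) ∣ m - 3 * n + 3)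
    (ρ𝔤 : (uFormGroup (Fin 2) (Fin 1)).lie →ₗ⁅ℝ⁆ Module.End ℂ (KIdx S →₀ ℂ))
    (hρ : ActsOnKTypes S ρ𝔤) :
    ∃ ρK : Representation ℂ (uFormGroup (Fin 2) (Fin 1)).maximalCompact (KIdx S →₀ ℂ),
      IsGKModule (uFormGroup (Fin 2) (Fin 1)) ρK ρ𝔤 :=
  ⟨kTypeRep S, isGKModule_kTypeRep hS ρ𝔤 hρ⟩

end GK

/-! ## §3 Kovačević's coordinates: `ρ𝔤|_𝔨` read off the eight-operator decomposition of `ρ` on `𝔤𝔩(3, ℂ)` -/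

section Kovacevic

variable {S : Set (ℤ × ℤ)}

/-- `Fin 2 ⊕ Fin 1 ≃ Fin 3` (the `β`-block LAST, as in ★ `F0P3bU21Restriction.u21ToGl3`): `0 ↦ inl 0`, `1 ↦ inl 1`, `2 ↦ inr 0`.
[cite: Kovacevic2021, §2] -/
theorem finSumFinEquiv_symm_fin_three :
    (finSumFinEquiv : Fin 2 ⊕ Fin 1 ≃ Fin 3).symm 0 = Sum.inl 0 ∧ (finSumFinEquiv : Fin 2 ⊕ Fin 1 ≃ Fin 3).symm 1 = Sum.inl 1 ∧
      (finSumFinEquiv : Fin 2 ⊕ Fin 1 ≃ Fin 3).symm 2 = Sum.inr 0 :=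
  ⟨by decide, by decide, by decide⟩

/-- **The reindexed matrix of `X ∈ 𝔨` is block diagonal in `𝔤𝔩(3, ℂ)`**: `M₀₂ = M₁₂ = M₂₀ = M₂₁ = 0` for
`M = reindex (Fin 2 ⊕ Fin 1 ≃ Fin 3) X` (★ `compactLie_blocks`), and its `𝔨`-entries are those of `X`. [cite: Kovacevic2021, §2] -/
theorem reindex_compactLie_entries (X : (uFormGroup (Fin 2) (Fin 1)).compactLie) :
    Matrix.reindex (finSumFinEquiv : Fin 2 ⊕ Fin 1 ≃ Fin 3) (finSumFinEquiv : Fin 2 ⊕ Fin 1 ≃ Fin 3)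
        (X : Matrix (Fin 2 ⊕ Fin 1) (Fin 2 ⊕ Fin 1) ℂ) 0 2 = 0 ∧
      Matrix.reindex (finSumFinEquiv : Fin 2 ⊕ Fin 1 ≃ Fin 3) (finSumFinEquiv : Fin 2 ⊕ Fin 1 ≃ Fin 3)
        (X : Matrix (Fin 2 ⊕ Fin 1) (Fin 2 ⊕ Fin 1) ℂ) 1 2 = 0 ∧
      Matrix.reindex (finSumFinEquiv : Fin 2 ⊕ Fin 1 ≃ Fin 3) (finSumFinEquiv : Fin 2 ⊕ Fin 1 ≃ Fin 3)
        (X : Matrix (Fin 2 ⊕ Fin 1) (Fin 2 ⊕ Fin 1) ℂ) 2 0 = 0 ∧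
      Matrix.reindex (finSumFinEquiv : Fin 2 ⊕ Fin 1 ≃ Fin 3) (finSumFinEquiv : Fin 2 ⊕ Fin 1 ≃ Fin 3)
        (X : Matrix (Fin 2 ⊕ Fin 1) (Fin 2 ⊕ Fin 1) ℂ) 2 1 = 0 ∧
      Matrix.reindex (finSumFinEquiv : Fin 2 ⊕ Fin 1 ≃ Fin 3) (finSumFinEquiv : Fin 2 ⊕ Fin 1 ≃ Fin 3)
        (X : Matrix (Fin 2 ⊕ Fin 1) (Fin 2 ⊕ Fin 1) ℂ) 0 0 = (X : Matrix (Fin 2 ⊕ Fin 1) (Fin 2 ⊕ Fin 1) ℂ) (Sum.inl 0) (Sum.inl 0) ∧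
      Matrix.reindex (finSumFinEquiv : Fin 2 ⊕ Fin 1 ≃ Fin 3) (finSumFinEquiv : Fin 2 ⊕ Fin 1 ≃ Fin 3)
        (X : Matrix (Fin 2 ⊕ Fin 1) (Fin 2 ⊕ Fin 1) ℂ) 0 1 = (X : Matrix (Fin 2 ⊕ Fin 1) (Fin 2 ⊕ Fin 1) ℂ) (Sum.inl 0) (Sum.inl 1) ∧
      Matrix.reindex (finSumFinEquiv : Fin 2 ⊕ Fin 1 ≃ Fin 3) (finSumFinEquiv : Fin 2 ⊕ Fin 1 ≃ Fin 3)
        (X : Matrix (Fin 2 ⊕ Fin 1) (Fin 2 ⊕ Fin 1) ℂ) 1 0 = (X : Matrix (Fin 2 ⊕ Fin 1) (Fin 2 ⊕ Fin 1) ℂ) (Sum.inl 1) (Sum.inl 0) ∧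
      Matrix.reindex (finSumFinEquiv : Fin 2 ⊕ Fin 1 ≃ Fin 3) (finSumFinEquiv : Fin 2 ⊕ Fin 1 ≃ Fin 3)
        (X : Matrix (Fin 2 ⊕ Fin 1) (Fin 2 ⊕ Fin 1) ℂ) 1 1 = (X : Matrix (Fin 2 ⊕ Fin 1) (Fin 2 ⊕ Fin 1) ℂ) (Sum.inl 1) (Sum.inl 1) ∧
      Matrix.reindex (finSumFinEquiv : Fin 2 ⊕ Fin 1 ≃ Fin 3) (finSumFinEquiv : Fin 2 ⊕ Fin 1 ≃ Fin 3)
        (X : Matrix (Fin 2 ⊕ Fin 1) (Fin 2 ⊕ Fin 1) ℂ) 2 2 = (X : Matrix (Fin 2 ⊕ Fin 1) (Fin 2 ⊕ Fin 1) ℂ) (Sum.inr 0) (Sum.inr 0) := by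
  obtain ⟨h12, h21, -, -⟩ := compactLie_blocks X
  obtain ⟨h0, h1, h2⟩ := finSumFinEquiv_symm_fin_three
  have e12 : ∀ i j, (X : Matrix (Fin 2 ⊕ Fin 1) (Fin 2 ⊕ Fin 1) ℂ) (Sum.inl i) (Sum.inr j) =
      (X : Matrix (Fin 2 ⊕ Fin 1) (Fin 2 ⊕ Fin 1) ℂ).toBlocks₁₂ i j := fun _ _ => rfl
  have e21 : ∀ i j, (X : Matrix (Fin 2 ⊕ Fin 1) (Fin 2 ⊕ Fin 1) ℂ) (Sum.inr i) (Sum.inl j) =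
      (X : Matrix (Fin 2 ⊕ Fin 1) (Fin 2 ⊕ Fin 1) ℂ).toBlocks₂₁ i j := fun _ _ => rfl
  refine ⟨?_, ?_, ?_, ?_, ?_, ?_, ?_, ?_, ?_⟩ <;>
    simp only [Matrix.reindex_apply, Matrix.submatrix_apply, h0, h1, h2, e12, e21, h12, h21, Matrix.zero_apply]

/-- **The `𝔨`-hypothesis in Kovačević's coordinates.**  `ActsOnKTypes S ρ𝔤` holds as soon as `ρ𝔤 X`, `X ∈ 𝔨`, is the eight-operator
combination `((2M₀₀−M₁₁−M₂₂)/3) Hα + ((M₀₀+M₁₁−2M₂₂)/3) Hβ + M₀₁ Xα + M₁₀ Yα + M₁₂ Xβ + M₂₁ Yβ + M₀₂ Xαβ + M₂₀ Yαβ` of the reindexed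
matrix `M` (the body of `SU21Datum.ρfun`, definitionally, for `ρ𝔤 = kovLie 𝒟.ρ`) and `Hα, Hβ, Xα, Yα` act on the basis by the shapes of
`SU21Datum.Ha_vec`, `Hb_vec`, `Xa_vec`, `Ya_vec` VERBATIM (`Xβ, Yβ, Xαβ, Yαβ` arbitrary — their coefficients vanish on `𝔨`,
`reindex_compactLie_entries`).  With `isGKModule_kTypeRep` this makes `(kTypeRep 𝒟.S, kovLie 𝒟.ρ)` a `(𝔤, K)`-module for every datum
with `6 ∣ m − 3n + 3` on its labels — for `ladderPlus` (`m = 3n − 3`) the line's `StubW1KIntegration`.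
[cite: Kovacevic2021, §3 Def. 1, Thm. 1] [cite: BorelWallach2000, 0 §2.5] -/
theorem actsOnKTypes_of_kovacevicForm (ρ𝔤 : (uFormGroup (Fin 2) (Fin 1)).lie →ₗ⁅ℝ⁆ Module.End ℂ (KIdx S →₀ ℂ))
    (Ha Hb Xa Ya Xb Yb Xab Yab : Module.End ℂ (KIdx S →₀ ℂ))
    (hρ𝔤 : ∀ X : (uFormGroup (Fin 2) (Fin 1)).compactLie,
      ρ𝔤 (LieSubalgebra.inclusion (uFormGroup (Fin 2) (Fin 1)).compactLie_le_lie X) =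
        ((2 * Matrix.reindex (finSumFinEquiv : Fin 2 ⊕ Fin 1 ≃ Fin 3) (finSumFinEquiv : Fin 2 ⊕ Fin 1 ≃ Fin 3)
                (X : Matrix (Fin 2 ⊕ Fin 1) (Fin 2 ⊕ Fin 1) ℂ) 0 0
              - Matrix.reindex (finSumFinEquiv : Fin 2 ⊕ Fin 1 ≃ Fin 3) (finSumFinEquiv : Fin 2 ⊕ Fin 1 ≃ Fin 3)
                (X : Matrix (Fin 2 ⊕ Fin 1) (Fin 2 ⊕ Fin 1) ℂ) 1 1
              - Matrix.reindex (finSumFinEquiv : Fin 2 ⊕ Fin 1 ≃ Fin 3) (finSumFinEquiv : Fin 2 ⊕ Fin 1 ≃ Fin 3)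
                (X : Matrix (Fin 2 ⊕ Fin 1) (Fin 2 ⊕ Fin 1) ℂ) 2 2) / 3) • Ha
        + ((Matrix.reindex (finSumFinEquiv : Fin 2 ⊕ Fin 1 ≃ Fin 3) (finSumFinEquiv : Fin 2 ⊕ Fin 1 ≃ Fin 3)
                (X : Matrix (Fin 2 ⊕ Fin 1) (Fin 2 ⊕ Fin 1) ℂ) 0 0
              + Matrix.reindex (finSumFinEquiv : Fin 2 ⊕ Fin 1 ≃ Fin 3) (finSumFinEquiv : Fin 2 ⊕ Fin 1 ≃ Fin 3)
                (X : Matrix (Fin 2 ⊕ Fin 1) (Fin 2 ⊕ Fin 1) ℂ) 1 1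
              - 2 * Matrix.reindex (finSumFinEquiv : Fin 2 ⊕ Fin 1 ≃ Fin 3) (finSumFinEquiv : Fin 2 ⊕ Fin 1 ≃ Fin 3)
                (X : Matrix (Fin 2 ⊕ Fin 1) (Fin 2 ⊕ Fin 1) ℂ) 2 2) / 3) • Hb
        + Matrix.reindex (finSumFinEquiv : Fin 2 ⊕ Fin 1 ≃ Fin 3) (finSumFinEquiv : Fin 2 ⊕ Fin 1 ≃ Fin 3)
            (X : Matrix (Fin 2 ⊕ Fin 1) (Fin 2 ⊕ Fin 1) ℂ) 0 1 • Xa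
        + Matrix.reindex (finSumFinEquiv : Fin 2 ⊕ Fin 1 ≃ Fin 3) (finSumFinEquiv : Fin 2 ⊕ Fin 1 ≃ Fin 3)
            (X : Matrix (Fin 2 ⊕ Fin 1) (Fin 2 ⊕ Fin 1) ℂ) 1 0 • Ya
        + Matrix.reindex (finSumFinEquiv : Fin 2 ⊕ Fin 1 ≃ Fin 3) (finSumFinEquiv : Fin 2 ⊕ Fin 1 ≃ Fin 3)
            (X : Matrix (Fin 2 ⊕ Fin 1) (Fin 2 ⊕ Fin 1) ℂ) 1 2 • Xb
        + Matrix.reindex (finSumFinEquiv : Fin 2 ⊕ Fin 1 ≃ Fin 3) (finSumFinEquiv : Fin 2 ⊕ Fin 1 ≃ Fin 3)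
            (X : Matrix (Fin 2 ⊕ Fin 1) (Fin 2 ⊕ Fin 1) ℂ) 2 1 • Yb
        + Matrix.reindex (finSumFinEquiv : Fin 2 ⊕ Fin 1 ≃ Fin 3) (finSumFinEquiv : Fin 2 ⊕ Fin 1 ≃ Fin 3)
            (X : Matrix (Fin 2 ⊕ Fin 1) (Fin 2 ⊕ Fin 1) ℂ) 0 2 • Xab
        + Matrix.reindex (finSumFinEquiv : Fin 2 ⊕ Fin 1 ≃ Fin 3) (finSumFinEquiv : Fin 2 ⊕ Fin 1 ≃ Fin 3)
            (X : Matrix (Fin 2 ⊕ Fin 1) (Fin 2 ⊕ Fin 1) ℂ) 2 0 • Yab)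
    (hHa : ∀ n m k : ℤ, Ha (kvec S n m k) = ((n : ℂ) + 1 - 2 * k) • kvec S n m k)
    (hHb : ∀ n m k : ℤ, Hb (kvec S n m k) = (((m : ℂ) - n - 1 + 2 * k) / 2) • kvec S n m k)
    (hXa : ∀ n m k : ℤ, Xa (kvec S n m k) = (-(((k : ℂ) - 1) * ((n : ℂ) + 1 - k))) • kvec S n m (k - 1))
    (hYa : ∀ (n m : ℤ) {k : ℤ}, 1 ≤ k → Ya (kvec S n m k) = -kvec S n m (k + 1)) :
    ActsOnKTypes S ρ𝔤 := by
  intro X n m k _ hk _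
  obtain ⟨h02, h12, h20, h21, h00, h01, h10, h11, h22⟩ := reindex_compactLie_entries X
  rw [hρ𝔤 X, h02, h12, h20, h21, h00, h01, h10, h11, h22]
  simp only [LinearMap.add_apply, LinearMap.smul_apply, zero_smul, add_zero, hHa, hHb, hXa, hYa n m hk, smul_smul,
    smul_neg]
  module

end Kovacevic

end Summit.HodgeConjecture.HodgeConjecture.Cruxes.H413.F0P3bKTypeIntegrationGK

end
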